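import Summits.HodgeConjecture.HodgeConjecture.Theses.CyclicUnitaryPowers
import Summits.HodgeConjecture.HodgeConjecture.Theorems.CyclicUnitaryPowersModelTransfer
import Summits.HodgeConjecture.HodgeConjecture.Theorems.CyclicUnitaryPowersDeckModelClauses
import Summits.HodgeConjecture.HodgeConjecture.Theorems.CyclicUnitaryPowersDeckHodgeOfCarlsonToledo
import Literature.AlgebraicGeometry.HodgeTheory.AlgebraicMonodromyMumfordTate
import Literature.AlgebraicGeometry.HodgeTheory.MumfordTateCommutatorsHodgeGroupAnyWeight
import Literature.AlgebraicGeometry.HodgeTheory.CyclicCoverReflectionMonodromy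
import Literature.AlgebraicGeometry.HodgeTheory.CyclicCoverEigenHodgeNumbers
import Literature.AlgebraicGeometry.HodgeTheory.BettiUniverseAxioms
import Literature.AlgebraicGeometry.HodgeTheory.ComplexConjugationHolds
import Literature.AlgebraicGeometry.HodgeTheory.HodgeRiemannPolarizabilityProofs
import Literature.AlgebraicGeometry.Motives.HodgeTensorFactsHolds

/-!
# K1 `VeryGeneralDeckCommutatorsInHg` of route `CyclicUnitaryPowers` — the ANDRÉ EXIT

Crux K1 (`stmt-HodgeConjecture-19544`): for a very general ternary `p`-form `f` (`p ≥ 7` prime) every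
smooth `X ⊂ ℙ³` cut out by `x₃^p − f` carries a morphism `σ` with the deck properties, such that every
commutator of two `σ*`-commuting `tr ∘ ∪`-isometries of `H²(X(ℂ);ℚ)` lies in the Hodge group.

The registered line `unitary-reflection-zariski` (v6, planner P3; prover lane A) exits through
CMSP 15.3.7 (i) (`deligne_finiteIndex_monodromy_le_mumfordTateGroup`: a FINITE-INDEX subgroup `Γ'` of
the monodromy group lies in `MT`) and brick B1 on `(⁅Γ', Γ'⁆)^Zar`, so its algebraic stub B2
(`stub_unitaryReflectionDensity`) must conclude `c ∈ glZariskiClosure ⁅Γ', Γ'⁆` for every finite-index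
`Γ'`.  This file proves the exit the route text itself names ("(3) André"; Two-layer plan:
`HgContainsMonodromyVeryGeneral` — "André normality: off a countable union of proper closed subsets the
Hodge group contains `G⁰_mon`, hence all `U_σ(ℚ)`-commutators"):

* **André's Theorem 1** (= CMSP Prop. 15.3.9 / Cor. 15.3.10), typed in the tree as the named fact
  `andre1992_algebraicMonodromy_normal_mumfordTateGroup`: at a Hodge-generic point the connected
  algebraic monodromy group `Mon_s = algebraicMonodromyGroup` is NORMAL in `MT(H²(𝒳_s))` and contained
  in its derived group `MT^der = derivedMumfordTateGroup` (its consumer corollary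
  `.subset_derivedMumfordTateGroup`);
* `MT^der(ℚ) ⊆ Hg(ℚ)` for the polarizable Hodge structure of the fibre (the landed any-weight B1,
  `derivedMumfordTateGroup_subset_hodgeGroup_of_isPolarizable`).

Consequently the algebra the crux needs from the monodromy group is ONLY the identity-component
statement D (hypothesis `hD` below): every commutator of two `τ`-commuting `B`-isometries lies in
`glIdentityComponent Γ` — i.e. in `glZariskiClosure Γ'` for every finite-index `Γ' ≤ Γ` — which is the
printed shape of the density theorems ("the connected algebraic monodromy group is …", Carlson–Toledo
1999 §7 per eigenspace; Xu, IMRN 2018) and is implied by B2 (`⁅Γ', Γ'⁆ ≤ Γ'`,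
`unitaryCommutatorsInMon_of_unitaryReflectionDensity`).  Main theorem:
`veryGeneralDeckCommutatorsInHg_of_andre` — K1 from the three Carlson–Toledo facts, the
Cattani–Deligne–Kaplan cover, André's theorem and D, kernel-checked; the
Deligne/CMSP 15.3.7 fact is not used.

The composition is the v6 composition of the registered line (planner P3 g19/g20, evidence #18 on the
item) with the exit replaced; the models-to-crux transfer is the landed `stub_cyclicModelTransfer`
(p513417), the deck clauses are the landed `exists_cyclicDeckModel_clauses_one_two` (p520277) and
`cyclicDeckHodge_of_carlsonToledo` (p523480), the envelope of the fibre is littype's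
`CarlsonToledoFamily.exists_envelopeKit` (p516872).
-/

noncomputable section

set_option linter.dupNamespace false

namespace Summit.HodgeConjecture.HodgeConjecture.Theorems.CyclicUnitaryPowersAndreExit

open Literature.AlgebraicGeometry.Motives Literature.AlgebraicGeometry.HodgeTheory
open Literature.AlgebraicGeometry.HodgeTheory.BettiUniverse
open Literature.AlgebraicTopology.SingularHomology
open CategoryTheory
open Summit.HodgeConjecture.HodgeConjecture.Theorems.CyclicUnitaryPowersDeckModelClauses

/-! ### B2 ⇒ D: the registered stub of lane A implies the identity-component form

**B2** = the registered stub `stub_unitaryReflectionDensity` of the line `unitary-reflection-zariski` (its signature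
VERBATIM, the hypothesis below): unitary `ζ`-reflection density concluding on `glZariskiClosure ⁅Γ', Γ'⁆` for every
finite-index `Γ' ≤ Γ`.

**D** (the conclusion below, and the hypothesis `hD` of the main theorem) = the identity-component form: same data and
hypotheses — a finite-dimensional `ℚ`-space `V`, `B` symmetric non-degenerate, a `B`-isometry `τ` with `τ^p = 1`
(`p ≥ 7` prime) and `dim V^τ ≤ 1`, a set `R ⊂ ker(1 + τ + ⋯ + τ^{p−1})` of vanishing vectors with non-degenerate
cyclic spans whose cyclic `τ`-reflections lie in and generate `Γ ≤ GL(V)(ℚ)`, one `Γ`-orbit of cyclic spans,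
spanning the anti-invariant part — and conclusion: every commutator of two `τ`-commuting `B`-isometries lies in
`glIdentityComponent Γ` = the `ℚ`-points of `(Γ^Zar)°` (the tree's rendering: the intersection of
`glZariskiClosure Γ'` over the finite-index `Γ' ≤ Γ`), i.e. in CMSP's `Mon` / André's connected monodromy group
`H_s` when `Γ` is the monodromy group of a family. -/



/-- **B2 ⇒ D**: the registered stub of lane A implies the identity-component form, because
`⁅Γ', Γ'⁆ ≤ Γ'` and the `ℚ`-Zariski closure is monotone; so the André exit needs no more algebra than the
Deligne-15.3.7 exit (and in fact less). -/
theorem unitaryCommutatorsInMon_of_unitaryReflectionDensity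
    (hB2 : open Literature.AlgebraicGeometry.Motives Literature.AlgebraicGeometry.HodgeTheory Literature.AlgebraicGeometry.HodgeTheory.BettiUniverse CategoryTheory.Limits in ∀ (V : Type) [AddCommGroup V] [Module ℚ V] [Module.Finite ℚ V] (B : LinearMap.BilinForm ℚ V) (τ : V ≃ₗ[ℚ] V) (p : ℕ) (R : Set V) (Γ : Subgroup (V ≃ₗ[ℚ] V)), p.Prime → 7 ≤ p → B.IsSymm → B.Nondegenerate → τ ^ p = 1 → (∀ x y, B (τ x) (τ y) = B x y) → Module.finrank ℚ ↥(Module.End.eigenspace (τ : V →ₗ[ℚ] V) 1) ≤ 1 → (∀ δ ∈ R, δ ≠ 0 ∧ (∑ i ∈ Finset.range p, (τ ^ i) δ) = 0 ∧ ∀ x ∈ Submodule.span ℚ (Set.range fun i : ℕ => (τ ^ i) δ), (∀ y ∈ Submodule.span ℚ (Set.range fun i : ℕ => (τ ^ i) δ), B x y = 0) → x = 0) → (∀ δ ∈ R, ∃ r ∈ Γ, ((∀ x ∈ Submodule.span ℚ (Set.range fun i : ℕ => (τ ^ i) δ), r x = τ x) ∧ (∀ x, (∀ y ∈ Submodule.span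 ℚ (Set.range fun i : ℕ => (τ ^ i) δ), B x y = 0) → r x = x))) → (Γ ≤ Subgroup.closure {r : V ≃ₗ[ℚ] V | ∃ δ ∈ R, ((∀ x ∈ Submodule.span ℚ (Set.range fun i : ℕ => (τ ^ i) δ), r x = τ x) ∧ (∀ x, (∀ y ∈ Submodule.span ℚ (Set.range fun i : ℕ => (τ ^ i) δ), B x y = 0) → r x = x))}) → (∀ δ ∈ R, ∀ δ' ∈ R, ∃ γ ∈ Γ, γ δ' ∈ Submodule.span ℚ (Set.range fun i : ℕ => (τ ^ i) δ)) → (∀ x, (∑ i ∈ Finset.range p, (τ ^ i) x) = 0 → x ∈ Submodule.span ℚ {y | ∃ δ ∈ R, ∃ i : ℕ, y = (τ ^ i) δ}) → ∀ Γ' : Subgroup (V ≃ₗ[ℚ] V), Γ' ≤ Γ → (Γ'.subgroupOf Γ).FiniteIndex → ∀ g h : V ≃ₗ[ℚ] V, (∀ x, g (τ x) = τ (g x)) → (∀ x y, B (g x) (g y) = B x y) → (∀ x, h (τ x) = τ (h x)) → (∀ x y, B (h x) (h y) = B x y) → g * h * g⁻¹ * h⁻¹ ∈ glZariskiClosure ⁅Γ',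 Γ'⁆) :
    open Literature.AlgebraicGeometry.Motives Literature.AlgebraicGeometry.HodgeTheory Literature.AlgebraicGeometry.HodgeTheory.BettiUniverse CategoryTheory.Limits in ∀ (V : Type) [AddCommGroup V] [Module ℚ V] [Module.Finite ℚ V] (B : LinearMap.BilinForm ℚ V) (τ : V ≃ₗ[ℚ] V) (p : ℕ) (R : Set V) (Γ : Subgroup (V ≃ₗ[ℚ] V)), p.Prime → 7 ≤ p → B.IsSymm → B.Nondegenerate → τ ^ p = 1 → (∀ x y, B (τ x) (τ y) = B x y) → Module.finrank ℚ ↥(Module.End.eigenspace (τ : V →ₗ[ℚ] V) 1) ≤ 1 → (∀ δ ∈ R, δ ≠ 0 ∧ (∑ i ∈ Finset.range p, (τ ^ i) δ) = 0 ∧ ∀ x ∈ Submodule.span ℚ (Set.range fun i : ℕ => (τ ^ i) δ), (∀ y ∈ Submodule.span ℚ (Set.range fun i : ℕ => (τ ^ i) δ), B x y = 0) → x = 0) → (∀ δ ∈ R, ∃ r ∈ Γ, ((∀ x ∈ Submodule.span ℚ (Set.range fun i : ℕ => (τ ^ i) δ), r x = τ x) ∧ (∀ x, (∀ y ∈ Submodule.span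 ℚ (Set.range fun i : ℕ => (τ ^ i) δ), B x y = 0) → r x = x))) → (Γ ≤ Subgroup.closure {r : V ≃ₗ[ℚ] V | ∃ δ ∈ R, ((∀ x ∈ Submodule.span ℚ (Set.range fun i : ℕ => (τ ^ i) δ), r x = τ x) ∧ (∀ x, (∀ y ∈ Submodule.span ℚ (Set.range fun i : ℕ => (τ ^ i) δ), B x y = 0) → r x = x))}) → (∀ δ ∈ R, ∀ δ' ∈ R, ∃ γ ∈ Γ, γ δ' ∈ Submodule.span ℚ (Set.range fun i : ℕ => (τ ^ i) δ)) → (∀ x, (∑ i ∈ Finset.range p, (τ ^ i) x) = 0 → x ∈ Submodule.span ℚ {y | ∃ δ ∈ R, ∃ i : ℕ, y = (τ ^ i) δ}) → ∀ g h : V ≃ₗ[ℚ] V, (∀ x, g (τ x) = τ (g x)) → (∀ x y, B (g x) (g y) = B x y) → (∀ x, h (τ x) = τ (h x)) → (∀ x y, B (h x) (h y) = B x y) → g * h * g⁻¹ * h⁻¹ ∈ glIdentityComponent Γ := by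
  intro V _ _ _ B τ p R Γ hp h7 hBs hBn hτp hτB hfix hP1 hP2 hP3 hP4 hP5 g h hgτ hgB hhτ hhB
  rw [mem_glIdentityComponent_iff]
  intro Γ' hΓ' hfi
  have hle : ⁅Γ', Γ'⁆ ≤ Γ' := Subgroup.commutator_le.mpr fun a ha b hb => by
    rw [commutatorElement_def]
    exact Γ'.mul_mem (Γ'.mul_mem (Γ'.mul_mem ha hb) (Γ'.inv_mem ha)) (Γ'.inv_mem hb)
  exact glZariskiClosure_mono hle
    (hB2 V B τ p R Γ hp h7 hBs hBn hτp hτB hfix hP1 hP2 hP3 hP4 hP5 Γ' hΓ' hfi g h hgτ hgB hhτ hhB)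

/-! ### The André exit: composition of K1 -/

/-- **K1 `VeryGeneralDeckCommutatorsInHg` by the ANDRÉ EXIT.**  Inputs: the Carlson–Toledo facts
(`nonempty_carlsonToledoFamily`: the universal family of `p`-cyclic covers of `ℙ²` with its Picard–Lefschetz
package; `carlsonToledo1999_finrank_eigenspace_deck_one` / `…_inf_hodgePiece`: the invariant line and the
eigen-Hodge numbers of the deck transformation), the Cattani–Deligne–Kaplan cover of the non-Hodge-generic
points (`cmsp_nonHodgeGenericPoints_countable_algebraic_cover`), **André's Theorem 1**
(`andre1992_algebraicMonodromy_normal_mumfordTateGroup`: `Mon_s ⊆ MT(H²(𝒳_s))^der` at a Hodge-generic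
`s`), and the algebraic statement D (hypothesis `hD`).  Proof: K1 on the models
`X_F = V₊(x₃^p − f)` implies K1 (landed transfer); the bad family is `a_(x₀^p)` (so that `f ≠ 0`) followed by
the polynomials cutting out the CDK cover, so a very general `f` classifies a Hodge-generic point
`s = pt f`; the deck clauses are the landed (o)–(ii) and (iii)–(iv); for two `σ*`-unitary automorphisms
`g, h` of `H²(X_F;ℚ)`, transport them along `φ : H²(𝒳_s;ℚ) ≃ H²(X_F;ℚ)` to `τ`-commuting isometries of
the cup-product form of the fibre, whose commutator D puts in `Mon_s = glIdentityComponent Γ_s`, André's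
theorem in `MT^der(ℚ)`, and `derivedMumfordTateGroup_subset_hodgeGroup_of_isPolarizable` (B1 at
`Γ' = MT`, the fibre's Hodge structure being polarizable) in the Hodge group of the fibre; the kit's
clause (HG) carries it back to `Hg(BettiUniverse.hodge hXF 2)`. -/
theorem veryGeneralDeckCommutatorsInHg_of_andre
    (hCT : nonempty_carlsonToledoFamily)
    (hCT1 : carlsonToledo1999_finrank_eigenspace_deck_one)
    (hCT2 : carlsonToledo1999_finrank_eigenspace_inf_hodgePiece)
    (hCDK : cmsp_nonHodgeGenericPoints_countable_algebraic_cover)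
    (hAndre : andre1992_algebraicMonodromy_normal_mumfordTateGroup)
    (hD : open Literature.AlgebraicGeometry.Motives Literature.AlgebraicGeometry.HodgeTheory Literature.AlgebraicGeometry.HodgeTheory.BettiUniverse CategoryTheory.Limits in ∀ (V : Type) [AddCommGroup V] [Module ℚ V] [Module.Finite ℚ V] (B : LinearMap.BilinForm ℚ V) (τ : V ≃ₗ[ℚ] V) (p : ℕ) (R : Set V) (Γ : Subgroup (V ≃ₗ[ℚ] V)), p.Prime → 7 ≤ p → B.IsSymm → B.Nondegenerate → τ ^ p = 1 → (∀ x y, B (τ x) (τ y) = B x y) → Module.finrank ℚ ↥(Module.End.eigenspace (τ : V →ₗ[ℚ] V) 1) ≤ 1 → (∀ δ ∈ R, δ ≠ 0 ∧ (∑ i ∈ Finset.range p, (τ ^ i) δ) = 0 ∧ ∀ x ∈ Submodule.span ℚ (Set.range fun i : ℕ => (τ ^ i) δ), (∀ y ∈ Submodule.span ℚ (Set.range fun i : ℕ => (τ ^ i) δ), B x y = 0) → x = 0) → (∀ δ ∈ R, ∃ r ∈ Γ, ((∀ x ∈ Submodule.span ℚ (Set.range fun i : ℕ => (τ ^ i)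 δ), r x = τ x) ∧ (∀ x, (∀ y ∈ Submodule.span ℚ (Set.range fun i : ℕ => (τ ^ i) δ), B x y = 0) → r x = x))) → (Γ ≤ Subgroup.closure {r : V ≃ₗ[ℚ] V | ∃ δ ∈ R, ((∀ x ∈ Submodule.span ℚ (Set.range fun i : ℕ => (τ ^ i) δ), r x = τ x) ∧ (∀ x, (∀ y ∈ Submodule.span ℚ (Set.range fun i : ℕ => (τ ^ i) δ), B x y = 0) → r x = x))}) → (∀ δ ∈ R, ∀ δ' ∈ R, ∃ γ ∈ Γ, γ δ' ∈ Submodule.span ℚ (Set.range fun i : ℕ => (τ ^ i) δ)) → (∀ x, (∑ i ∈ Finset.range p, (τ ^ i) x) = 0 → x ∈ Submodule.span ℚ {y | ∃ δ ∈ R, ∃ i : ℕ, y = (τ ^ i) δ}) → ∀ g h : V ≃ₗ[ℚ] V, (∀ x, g (τ x) = τ (g x)) → (∀ x y, B (g x) (g y) = B x y) → (∀ x, h (τ x) = τ (h x)) → (∀ x y, B (h x) (h y) = B x y) → g * h * g⁻¹ * h⁻¹ ∈ glIdentityComponent Γ) :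
    Summit.HodgeConjecture.HodgeConjecture.Theses.CyclicUnitaryPowers.VeryGeneralDeckCommutatorsInHg := by
  have hDeckH := Summit.HodgeConjecture.HodgeConjecture.Theorems.CyclicUnitaryPowersDeckHodgeOfCarlsonToledo.cyclicDeckHodge_of_carlsonToledo hCT1 hCT2
  refine Summit.HodgeConjecture.HodgeConjecture.Theorems.CyclicUnitaryPowersModelTransfer.stub_cyclicModelTransfer ?_
  intro p hp h7
  have hodd : Odd p := hp.odd_of_ne_two (by omega)
  obtain ⟨𝔉⟩ := hCT hodd (by omega)
  haveI hHTF : HodgeTensorFacts.{0, 0} := hodgeTensorFacts_holds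
  haveI : ∀ t : ComplexPoints 𝔉.S, Module.Finite ℚ (bettiCohomology (fiberOver 𝔉.u t) 2) := fun t => 𝔉.finite t 2
  -- real (hence Hodge-symmetric) Hodge models of the fibres
  have hAm := fun t : ComplexPoints 𝔉.S =>
    exists_isReal_hodgeModel_holds.exists_isHodgeSymmetric (𝔉.isSmoothProjectiveFamily.isSmoothProjective t)
  let A : ∀ t : ComplexPoints 𝔉.S, HodgeModel 2 (fiberOver 𝔉.u t) := fun t => (hAm t).choose
  have hA : ∀ t, (A t).IsHodgeSymmetric := fun t => (hAm t).choose_spec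
  -- the Cattani–Deligne–Kaplan cover of the non-Hodge-generic points of the base
  obtain ⟨W, hW, hcov⟩ := hCDK 𝔉.u 2 2 𝔉.isSmoothProjectiveFamily 𝔉.isQuasiProjectiveOver 𝔉.smooth
    𝔉.irreducibleSpace 𝔉.locallyTrivial A hA
  -- each member of the cover is avoided off one nonzero polynomial condition on the coefficients
  choose G hG₀ hG using fun j => 𝔉.alg (W j) (hW j).1 (hW j).2
  -- the bad family: the coordinate `a_(x₀^p)` (forcing `f ≠ 0`) followed by the `G j`
  have hdeg : (Finsupp.single (0 : Fin 3) p).degree = p := by simp [Finsupp.degree_single]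
  refine ⟨fun i => if i = 0 then MvPolynomial.X ⟨Finsupp.single 0 p, hdeg⟩ else G (i - 1), ?_, ?_⟩
  · intro i
    by_cases hi : i = 0
    · subst hi
      refine ⟨MvPolynomial.X 0 ^ p, by simpa using (MvPolynomial.isHomogeneous_X ℂ (0 : Fin 3)).pow p, ?_⟩
      simp [MvPolynomial.coeff_X_pow]
    · simpa only [hi, if_false] using hG₀ (i - 1)
  intro f hf hgen' hXF ha
  have hf0 : f ≠ 0 := by
    rintro rfl
    exact hgen' 0 (by simp)
  have hgen : ∀ j, MvPolynomial.eval (fun d : {d : Fin 3 →₀ ℕ // d.degree = p} => f.coeff d.1) (G j) ≠ 0 :=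
    fun j => by simpa only [Nat.succ_ne_zero, if_false, Nat.add_sub_cancel] using hgen' (j + 1)
  -- the deck clauses on the model: (o)–(ii) routine (landed), (iii)–(iv) from the Carlson–Toledo facts
  obtain ⟨ha', h1, h2⟩ := exists_cyclicDeckModel_clauses_one_two hp.ne_zero f hXF
  obtain ⟨h3, h4⟩ := hDeckH hp h7 f hf hf0 hXF ha
  have h1' : pull (diagonalAut (MvPolynomial.X (Fin.last 3) ^ p - MvPolynomial.rename Fin.castSucc f) ha) 2 ^ p = 1 := by
    rw [diagonalAut_congr _ ha ha' rfl]; exact h1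
  have h2' : ∀ x y, tr hXF (2 + 2) (cup _ 2 2
      (pull (diagonalAut (MvPolynomial.X (Fin.last 3) ^ p - MvPolynomial.rename Fin.castSucc f) ha) 2 x)
      (pull (diagonalAut (MvPolynomial.X (Fin.last 3) ^ p - MvPolynomial.rename Fin.castSucc f) ha) 2 y)) =
      tr hXF (2 + 2) (cup _ 2 2 x y) := by
    rw [diagonalAut_congr _ ha ha' rfl]; exact h2
  refine ⟨⟨h1', h2', h3, h4⟩, ?_⟩
  intro g h hg hh
  -- the envelope kit of the fibre over the classifying point `s = pt f`
  have hXF' : IsSmoothProjective 2 (SmoothHypersurface.hypersurface (cyclicCoverForm p f)) := hXF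
  have haF : deckUnit p ∈ diagonalStabilizer (cyclicCoverForm p f) := ha
  obtain ⟨φ, B, hBs, hBn, τ, hτp, R, hτB, hφτ, hφB, hHG, hfix, hP1, hP2, hP3, hP4, hP5⟩ :=
    𝔉.exists_envelopeKit f hf hf0 hXF' haF exists_isReal_hodgeModel_holds hodgePQ_independent_of_hodgeModel_holds
      h1' h2' h3.le (A (𝔉.pt f)) (hA (𝔉.pt f))
  -- re-type `φ` on the route's spelling of the model (`cyclicCoverForm p f` unfolds to it), so that
  -- `simp` lemmas match syntactically below
  obtain ⟨φ, rfl⟩ : ∃ φ' : bettiCohomology (fiberOver 𝔉.u (𝔉.pt f)) 2 ≃ₗ[ℚ]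
      bettiCohomology (SmoothHypersurface.hypersurface
        (MvPolynomial.X (Fin.last 3) ^ p - MvPolynomial.rename Fin.castSucc f)) 2, φ' = φ := ⟨φ, rfl⟩
  haveI := finite hXF 2
  -- the kit clauses used below, on the route's spelling of the model
  have hφτ' : ∀ x, φ (τ x) =
      pull (diagonalAut (MvPolynomial.X (Fin.last 3) ^ p - MvPolynomial.rename Fin.castSucc f) ha) 2 (φ x) := hφτ
  have hφB' : ∀ x y, B x y = tr hXF (2 + 2) (cup (SmoothHypersurface.hypersurface
      (MvPolynomial.X (Fin.last 3) ^ p - MvPolynomial.rename Fin.castSucc f)) 2 2 (φ x) (φ y)) := hφB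
  have hHG' : ∀ k : bettiCohomology (fiberOver 𝔉.u (𝔉.pt f)) 2 ≃ₗ[ℚ] bettiCohomology (fiberOver 𝔉.u (𝔉.pt f)) 2,
      k ∈ ((A (𝔉.pt f)).hodgeStructure (𝔉.isSmoothProjectiveFamily.isSmoothProjective (𝔉.pt f)) (hA (𝔉.pt f)) 2).hodgeGroup →
        (φ.symm.trans k).trans φ ∈ (hodge exists_isReal_hodgeModel_holds hXF 2).hodgeGroup := hHG
  -- the classifying point of a very general member is Hodge generic
  have hsgen : IsHodgeGenericPoint 𝔉.u 2 𝔉.locallyTrivial 𝔉.isSmoothProjectiveFamily A hA ⟨𝔉.pt f, Set.mem_univ _⟩ := by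
    by_contra hns
    obtain ⟨j, hj⟩ := hcov ⟨𝔉.pt f, Set.mem_univ _⟩ hns
    exact hG j f hf hXF (hgen j) hj
  -- André's Theorem 1: `Mon_s ⊆ MT(H²(𝒳_s))^der`
  have hMon := hAndre.subset_derivedMumfordTateGroup 𝔉.u 2 2 𝔉.isSmoothProjectiveFamily 𝔉.isQuasiProjectiveOver
    𝔉.smooth 𝔉.locallyTrivial A hA ⟨𝔉.pt f, Set.mem_univ _⟩ hsgen
  -- transport the two σ-unitary automorphisms to the fibre
  have hστ : ∀ y, τ (φ.symm y) =
      φ.symm (pull (diagonalAut (MvPolynomial.X (Fin.last 3) ^ p - MvPolynomial.rename Fin.castSucc f) ha) 2 y) :=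
    fun y => by
    apply φ.injective
    rw [hφτ', LinearEquiv.apply_symm_apply, LinearEquiv.apply_symm_apply]
  have cenτ : ∀ k : bettiCohomology (SmoothHypersurface.hypersurface
        (MvPolynomial.X (Fin.last 3) ^ p - MvPolynomial.rename Fin.castSucc f)) 2 ≃ₗ[ℚ]
      bettiCohomology (SmoothHypersurface.hypersurface
        (MvPolynomial.X (Fin.last 3) ^ p - MvPolynomial.rename Fin.castSucc f)) 2,
      (∀ x, k (pull (diagonalAut (MvPolynomial.X (Fin.last 3) ^ p - MvPolynomial.rename Fin.castSucc f) ha) 2 x) =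
        pull (diagonalAut (MvPolynomial.X (Fin.last 3) ^ p - MvPolynomial.rename Fin.castSucc f) ha) 2 (k x)) →
      ∀ x, ((φ.trans k).trans φ.symm) (τ x) = τ (((φ.trans k).trans φ.symm) x) := by
    intro k hk x
    simp only [LinearEquiv.trans_apply]
    rw [hφτ', hk, hστ]
  have cenB : ∀ k : bettiCohomology (SmoothHypersurface.hypersurface
        (MvPolynomial.X (Fin.last 3) ^ p - MvPolynomial.rename Fin.castSucc f)) 2 ≃ₗ[ℚ]
      bettiCohomology (SmoothHypersurface.hypersurface
        (MvPolynomial.X (Fin.last 3) ^ p - MvPolynomial.rename Fin.castSucc f)) 2,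
      (∀ x y, tr hXF (2 + 2) (cup (SmoothHypersurface.hypersurface
          (MvPolynomial.X (Fin.last 3) ^ p - MvPolynomial.rename Fin.castSucc f)) 2 2 (k x) (k y)) =
        tr hXF (2 + 2) (cup (SmoothHypersurface.hypersurface
          (MvPolynomial.X (Fin.last 3) ^ p - MvPolynomial.rename Fin.castSucc f)) 2 2 x y)) →
      ∀ x y, B (((φ.trans k).trans φ.symm) x) (((φ.trans k).trans φ.symm) y) = B x y := by
    intro k hk x y
    simp only [LinearEquiv.trans_apply]
    rw [hφB', LinearEquiv.apply_symm_apply, LinearEquiv.apply_symm_apply, hk, ← hφB']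
  -- D: the commutator of the transported pair lies in `Mon_s = glIdentityComponent Γ_s`
  have hc : ((φ.trans g).trans φ.symm) * ((φ.trans h).trans φ.symm) * ((φ.trans g).trans φ.symm)⁻¹ *
      ((φ.trans h).trans φ.symm)⁻¹ ∈
      algebraicMonodromyGroup 𝔉.u 2 𝔉.locallyTrivial ⟨𝔉.pt f, Set.mem_univ _⟩ :=
    hD (bettiCohomology (fiberOver 𝔉.u (𝔉.pt f)) 2) B τ p R (ratMonodromyGroup 𝔉.u 2 𝔉.locallyTrivial ⟨𝔉.pt f, Set.mem_univ _⟩)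
      hp h7 hBs hBn hτp hτB hfix hP1 hP2 hP3 hP4 hP5
      ((φ.trans g).trans φ.symm) ((φ.trans h).trans φ.symm) (cenτ g hg.1) (cenB g hg.2) (cenτ h hh.1) (cenB h hh.2)
  -- B1 at `Γ' = MT`: `MT^der(ℚ) ⊆ Hg(ℚ)` for the polarizable Hodge structure of the fibre
  have hcomm := derivedMumfordTateGroup_subset_hodgeGroup_of_isPolarizable
    ((A (𝔉.pt f)).hodgeStructure (𝔉.isSmoothProjectiveFamily.isSmoothProjective (𝔉.pt f)) (hA (𝔉.pt f)) 2)
    (smoothProjective_hodgeStructure_isPolarizable_holds (𝔉.isSmoothProjectiveFamily.isSmoothProjective (𝔉.pt f))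
      (A (𝔉.pt f)) (hA (𝔉.pt f)) 2) (hMon hc)
  -- transport back to `H²(X_F;ℚ)` along `φ`
  have hback := hHG' _ hcomm
  have hid : (φ.symm.trans (((φ.trans g).trans φ.symm) * ((φ.trans h).trans φ.symm) * ((φ.trans g).trans φ.symm)⁻¹ *
      ((φ.trans h).trans φ.symm)⁻¹)).trans φ = g * h * g⁻¹ * h⁻¹ := by
    ext x
    simp only [LinearEquiv.mul_apply, LinearEquiv.trans_apply, LinearEquiv.coe_inv, LinearEquiv.symm_trans_apply,
      LinearEquiv.symm_symm, LinearEquiv.apply_symm_apply]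
  rw [← hid]
  exact hback

end Summit.HodgeConjecture.HodgeConjecture.Theorems.CyclicUnitaryPowersAndreExit

end
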